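import Literature.AlgebraicGeometry.Frobenioids.PreFrobenioidPullbacks
import Literature.AlgebraicGeometry.Frobenioids.ElementaryIsomorphisms
import Literature.AlgebraicGeometry.Frobenioids.Composites
import HarnessLib

/-!
# Frobenioids I, Proposition 1.6 (Categorical Fiber Products) — part 1: `Φ′`, (i), the functor
# `C′ → F_{Φ′}`, and `C′` is a pre-Frobenioid (STEP-0 calibration fragment of the abc-iut cell)

Mochizuki, *The geometry of Frobenioids I: the general theory*, Kyushu J. Math. **62** (2008)
293–400, §1, Proposition 1.6 "(Categorical Fiber Products)" and its proof, kurims text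
pp. 27–28 [cite: MochizukiFrdI2008, Prop. 1.6]:

> "Let `Φ` be a divisorial monoid on a connected, totally epimorphic category `D`; `C → F_Φ` a
> Frobenioid. Let `D′` be a connected, totally epimorphic category; `D′ → D` a functor that maps
> FSM-morphisms to FSM-morphisms. Denote by `Φ′ : D′ → Mon` the divisorial monoid obtained by
> restricting `Φ` to `D′`. Then: (i) There is a natural equivalence of categories
> `F_{Φ′} ⥲ F_Φ ×_D D′`. (ii) The categorical fiber product `C′ := C ×_D D′` equipped with the
> functor `C′ → F_{Φ′}` [obtained by applying "`(−) ×_D D′`" to the functor `C → F_Φ`] is a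
> Frobenioid. (iii) A morphism of `C′` is a(n) isometry (respectively, morphism of a given
> Frobenius degree; co-angular morphism; LB-invertible morphism; pull-back morphism) if and only
> if its projection to `C` is. (iv) A base-isomorphism of `C′` is a morphism of Frobenius type
> (respectively, pre-step; step) if and only if its projection to `C` is. Moreover, the projection
> functor `C′ → C` determines a bijection of monoids `O^▷(A′) ⥲ O^▷(A)`, for every `A′ ∈ Ob(C′)`
> that projects to `A ∈ Ob(C)`. (v) A object of `C′` is Frobenius-trivial (respectively, …;
> isotropic; Frobenius-isotropic) if and only if it projects to such an object of `C`. (vi) A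
> object of `C′` is Aut-ample (respectively, Aut^sub-ample; End-ample) if it projects to such an
> object of `C`."

This file: the restricted monoid `Φ′`; (i) as an equivalence (`toFiberProduct`, full, faithful,

This file: the restricted monoid `Φ′`; (i) as an equivalence (`toFiberProduct`, full, faithful,
essentially surjective); the functor `C′ → F_{Φ′}` of (ii), written down directly
(`(γ, γ′) ↦ (γ′, (α⁻¹)^* Div γ, deg_Fr γ)` for an object `(A, A′, α : A_D ≅ D′→D (A′))`), which
is the text's "`(−) ×_D D′` applied to `C → F_Φ`" composed with (i); lifting of arrows of `C`
with invertible projection to `C′`; and the first half of the proof of (ii) — `C′` is totally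
epimorphic, and connected "in light of the various properties of the natural projection functor
`C → D` assumed in Definition 1.3, (i), (a), (b), (c)" — so that `C′ → F_{Φ′}` is a pre-Frobenioid.
Parts 2–4: `FiberProductsMorphisms.lean` ((iii), (iv), parts of (v), (vi)),
`FiberProductsFrobenioid*.lean` (the clauses of Def. 1.3 for `C′`), `FiberProductsObjects.lean`.
No statement of the paper is strengthened.
-/

namespace Literature.AlgebraicGeometry.Frobenioids

open CategoryTheory Opposite

universe w v v' v'' u u' u''

/-! ### Isomorphisms in a categorical fiber product (formal, §0 p. 17) -/

namespace CFP

variable {C₁ : Type u} [Category.{v} C₁] {C₂ : Type u'} [Category.{v'} C₂]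
  {D : Type u''} [Category.{v''} D] {Φ₁ : C₁ ⥤ D} {Φ₂ : C₂ ⥤ D}

/-- An isomorphism of `C₁ ×_D C₂` from compatible isomorphisms of the components.
[cite: MochizukiFrdI2008, §0 p.17] -/
def isoMk {X Y : CFP Φ₁ Φ₂} (e₁ : X.fst ≅ Y.fst) (e₂ : X.snd ≅ Y.snd)
    (w : Φ₁.map e₁.hom ≫ Y.iso.hom = X.iso.hom ≫ Φ₂.map e₂.hom) : X ≅ Y where
  hom := ⟨e₁.hom, e₂.hom, w⟩
  inv := ⟨e₁.inv, e₂.inv, by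
    show (Φ₁.mapIso e₁).inv ≫ X.iso.hom = Y.iso.hom ≫ (Φ₂.mapIso e₂).inv
    rw [Iso.inv_comp_eq, ← Category.assoc, Iso.eq_comp_inv]
    exact w.symm⟩
  hom_inv_id := hom_ext e₁.hom_inv_id e₂.hom_inv_id
  inv_hom_id := hom_ext e₁.inv_hom_id e₂.inv_hom_id

/-- A morphism of `C₁ ×_D C₂` whose two components are isomorphisms is an isomorphism.
[cite: MochizukiFrdI2008, §0 p.17] -/
theorem isIso_of_isIso_fst_snd {X Y : CFP Φ₁ Φ₂} (f : X ⟶ Y) [IsIso f.fst] [IsIso f.snd] :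
    IsIso f :=
  ⟨⟨(isoMk (asIso f.fst) (asIso f.snd) f.w).inv,
    (isoMk (asIso f.fst) (asIso f.snd) f.w).hom_inv_id,
    (isoMk (asIso f.fst) (asIso f.snd) f.w).inv_hom_id⟩⟩

/-- The first projection of an isomorphism of `C₁ ×_D C₂` is an isomorphism. [cite: MochizukiFrdI2008, §0 p.17] -/
theorem isIso_fst {X Y : CFP Φ₁ Φ₂} (f : X ⟶ Y) [IsIso f] : IsIso f.fst :=
  (inferInstance : IsIso ((proj₁ Φ₁ Φ₂).map f))

/-- The second projection of an isomorphism of `C₁ ×_D C₂` is an isomorphism. [cite: MochizukiFrdI2008, §0 p.17] -/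
theorem isIso_snd {X Y : CFP Φ₁ Φ₂} (f : X ⟶ Y) [IsIso f] : IsIso f.snd :=
  (inferInstance : IsIso ((proj₂ Φ₁ Φ₂).map f))

end CFP

/-! ### The restriction `Φ′` of `Φ` along `D′ → D` -/

section Restrict

variable {D : Type u} [Category.{v} D] {D' : Type u'} [Category.{v'} D']

variable (Φ : Dᵒᵖ ⥤ CommMonCat.{w}) (G : D' ⥤ D)

/-- `Φ′`: "the divisorial monoid obtained by restricting `Φ` to `D′`" along `D′ → D`
(FrdI Prop. 1.6). [cite: MochizukiFrdI2008, Prop. 1.6] -/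
abbrev restrictMonoid : D'ᵒᵖ ⥤ CommMonCat.{w} := G.op ⋙ Φ

/-- Pull-backs of `Φ′` are pull-backs of `Φ` along the images of arrows. [cite: MochizukiFrdI2008, Prop. 1.6] -/
theorem pull_restrictMonoid {A B : D'} (f : B ⟶ A) (x : (restrictMonoid Φ G).obj (op A)) :
    pull (restrictMonoid Φ G) f x = pull Φ (G.map f) x := rfl

variable {Φ G}

/-- If `D′ → D` maps FSM-morphisms to FSM-morphisms, the restriction of a monoid on `D` is a monoid
on `D′` (FrdI Prop. 1.6, standing construction). [cite: MochizukiFrdI2008, Prop. 1.6] -/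
theorem isMonoidOn_restrictMonoid (hΦ : IsMonoidOn Φ)
    (hG : ∀ {A B : D'} (f : B ⟶ A), IsFSM f → IsFSM (G.map f)) :
    IsMonoidOn (restrictMonoid Φ G) :=
  ⟨fun f => hΦ.isCharInjective (G.map f), fun f hf => hΦ.bijective_of_isFSM (G.map f) (hG f hf)⟩

/-- Objectwise properties of `Φ` restrict. [cite: MochizukiFrdI2008, Prop. 1.6] -/
theorem objectwise_restrictMonoid {P : ∀ (M : Type w) [CommMonoid M], Prop} (h : Objectwise P Φ) :
    Objectwise P (restrictMonoid Φ G) :=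
  fun A => h (G.obj A)

end Restrict

/-! ### Proposition 1.6 (i): `F_{Φ′} ⥲ F_Φ ×_D D′` -/

namespace ElemFrobenioid

variable {D : Type u} [Category.{v} D] {D' : Type u'} [Category.{v'} D']
  {Φ : Dᵒᵖ ⥤ CommMonCat.{w}} {G : D' ⥤ D}

variable (Φ G) in
/-- The functor `F_{Φ′} → F_Φ ×_D D′`: `A′ ↦ (D′→D (A′), A′, id)`, `(f′, Z, n) ↦ ((f′_D, Z, n), f′)`
(FrdI Prop. 1.6 (i)). [cite: MochizukiFrdI2008, Prop. 1.6] -/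
def toFiberProduct : ElemFrobenioid (restrictMonoid Φ G) ⥤ CFP (baseFunctor Φ) G where
  obj A' := ⟨of Φ (G.obj A'.base), A'.base, Iso.refl _⟩
  map {A' B'} φ := ⟨homMk (G.map φ.base) φ.div φ.degFr, φ.base, by
    show G.map φ.base ≫ 𝟙 (G.obj B'.base) = 𝟙 (G.obj A'.base) ≫ G.map φ.base
    rw [Category.comp_id, Category.id_comp]⟩
  map_id A' := CFP.hom_ext (Hom.ext (G.map_id _) rfl rfl) rfl
  map_comp φ ψ := CFP.hom_ext (Hom.ext (G.map_comp _ _) rfl rfl) rfl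

/-- `F_{Φ′} → F_Φ ×_D D′` is faithful. [cite: MochizukiFrdI2008, Prop. 1.6] -/
theorem toFiberProduct_faithful : (toFiberProduct Φ G).Faithful := by
  refine ⟨fun {A' B'} {φ ψ} h => ?_⟩
  have h₁ : φ.base = ψ.base := congrArg CFP.Hom.snd h
  have h₂ : φ.div = ψ.div := congrArg (fun k => Hom.div (CFP.Hom.fst k)) h
  have h₃ : φ.degFr = ψ.degFr := congrArg (fun k => Hom.degFr (CFP.Hom.fst k)) h
  exact Hom.ext h₁ h₂ h₃

/-- `F_{Φ′} → F_Φ ×_D D′` is full. [cite: MochizukiFrdI2008, Prop. 1.6] -/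
theorem toFiberProduct_full : (toFiberProduct Φ G).Full := by
  refine ⟨fun {A' B'} f => ?_⟩
  have hw : f.fst.base = G.map f.snd := ((Category.comp_id _).symm.trans f.w).trans (Category.id_comp _)
  exact ⟨homMk f.snd f.fst.div f.fst.degFr, CFP.hom_ext (Hom.ext hw.symm rfl rfl) rfl⟩

/-- `F_{Φ′} → F_Φ ×_D D′` is essentially surjective: `(A, A′, α) ≅ (D′→D (A′), A′, id)` via
`(α⁻¹, 0, 1)`. [cite: MochizukiFrdI2008, Prop. 1.6] -/
theorem toFiberProduct_essSurj : (toFiberProduct Φ G).EssSurj := by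
  refine ⟨fun X => ⟨of (restrictMonoid Φ G) X.snd, ⟨?_⟩⟩⟩
  let i : G.obj X.snd ⟶ X.fst.base := X.iso.inv
  haveI : IsIso i := inferInstanceAs (IsIso X.iso.inv)
  let m : of Φ (G.obj X.snd) ⟶ X.fst := homMk i (1 : Φ.obj (op (G.obj X.snd))) 1
  have hm : IsIso m := isIso_homMk (A := of Φ (G.obj X.snd)) (B := X.fst) i isUnit_one
  refine CFP.isoMk (@asIso _ _ _ _ m hm) (Iso.refl _) ?_
  show X.iso.inv ≫ X.iso.hom = 𝟙 _ ≫ G.map (𝟙 _)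
  rw [Iso.inv_hom_id, G.map_id, Category.comp_id]

/-- **FrdI Prop. 1.6 (i)**: `F_{Φ′} → F_Φ ×_D D′` is an equivalence of categories.
[cite: MochizukiFrdI2008, Prop. 1.6] -/
theorem toFiberProduct_isEquivalence : (toFiberProduct Φ G).IsEquivalence :=
  haveI := toFiberProduct_faithful (Φ := Φ) (G := G)
  haveI := toFiberProduct_full (Φ := Φ) (G := G)
  haveI := toFiberProduct_essSurj (Φ := Φ) (G := G)
  {}

end ElemFrobenioid

/-! ### The category `C′ = C ×_D D′` and the functor `C′ → F_{Φ′}` -/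

namespace PreFrobenioid

variable {D : Type u} [Category.{v} D] {D' : Type u'} [Category.{v'} D']
  {Φ : Dᵒᵖ ⥤ CommMonCat.{w}} {C : Type u''} [Category.{v''} C]
  (F : C ⥤ ElemFrobenioid Φ) (G : D' ⥤ D)

/-- `C′ := C ×_D D′`, the categorical fiber product of the projection `C → D` with `D′ → D`
(FrdI Prop. 1.6 (ii)). [cite: MochizukiFrdI2008, Prop. 1.6] -/
abbrev FiberProduct : Type (max u'' u' v) := CFP (baseFunctor F) G

namespace FiberProduct

variable {F G}

/-- The identification `α : A_D ≅ D′→D (A′)` of an object `(A, A′, α)` of `C′`, with its domain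
spelled `A_D`. [cite: MochizukiFrdI2008, Prop. 1.6] -/
def e (X : FiberProduct F G) : baseObj F X.fst ≅ G.obj X.snd := X.iso

/-- `e` of a triple. [cite: MochizukiFrdI2008, Prop. 1.6] -/
@[simp] theorem e_mk (A : C) (A' : D') (α : baseObj F A ≅ G.obj A') :
    e (⟨A, A', α⟩ : FiberProduct F G) = α := rfl

/-- The compatibility square of an arrow `(γ, γ′)` of `C′`: `β ∘ γ_D = γ′_D ∘ α`.
[cite: MochizukiFrdI2008, Prop. 1.6] -/
theorem hom_w {X Y : FiberProduct F G} (f : X ⟶ Y) : Base F f.fst ≫ Y.e.hom = X.e.hom ≫ G.map f.snd :=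
  f.w

/-- For an arrow `(γ, γ′) : (A, A′, α) → (B, B′, β)` of `C′`: `α⁻¹ ∘ γ_D = γ′_D ∘ β⁻¹`.
[cite: MochizukiFrdI2008, Prop. 1.6] -/
theorem inv_comp_base {X Y : FiberProduct F G} (f : X ⟶ Y) :
    X.e.inv ≫ Base F f.fst = G.map f.snd ≫ Y.e.inv := by
  rw [Iso.inv_comp_eq, ← Category.assoc, Iso.eq_comp_inv]
  exact hom_w f

end FiberProduct

/-- The functor `C′ → F_{Φ′}` of FrdI Prop. 1.6 (ii) ("obtained by applying `(−) ×_D D′` to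
`C → F_Φ`", composed with (i)): `(A, A′, α) ↦ A′`, `(γ, γ′) ↦ (γ′, (α⁻¹)^* Div(γ), deg_Fr(γ))`.
[cite: MochizukiFrdI2008, Prop. 1.6] -/
def fiberProductFunctor : FiberProduct F G ⥤ ElemFrobenioid (restrictMonoid Φ G) where
  obj X := ElemFrobenioid.of (restrictMonoid Φ G) X.snd
  map {X Y} f := ElemFrobenioid.homMk f.snd (pull Φ X.e.inv (Div F f.fst)) (degFr F f.fst)
  map_id X := ElemFrobenioid.Hom.ext rfl
    (by
      show pull Φ X.e.inv (Div F (𝟙 X.fst)) = 1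
      rw [div_id, map_one])
    (degFr_id F X.fst)
  map_comp {X Y Z} f g := ElemFrobenioid.Hom.ext rfl
    (by
      show pull Φ X.e.inv (Div F (f.fst ≫ g.fst)) =
        pull Φ (G.map f.snd) (pull Φ Y.e.inv (Div F g.fst)) *
          (pull Φ X.e.inv (Div F f.fst)) ^ (degFr F g.fst : ℕ)
      rw [div_comp, map_mul, map_pow, ← pull_comp, ← pull_comp, FiberProduct.inv_comp_base])
    (degFr_comp F f.fst g.fst)

/-! ### Dictionary for `C′ → F_{Φ′}` -/

variable {F G}

/-- `Base` of `(γ, γ′)` is `γ′`. [cite: MochizukiFrdI2008, Prop. 1.6] -/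
theorem fiberProduct_base {X Y : FiberProduct F G} (f : X ⟶ Y) :
    Base (fiberProductFunctor F G) f = f.snd := rfl

/-- `Div` of `(γ, γ′)` is `(α⁻¹)^* Div(γ)`. [cite: MochizukiFrdI2008, Prop. 1.6] -/
theorem fiberProduct_div {X Y : FiberProduct F G} (f : X ⟶ Y) :
    Div (fiberProductFunctor F G) f = pull Φ X.e.inv (Div F f.fst) := rfl

/-- `deg_Fr` of `(γ, γ′)` is `deg_Fr(γ)`. [cite: MochizukiFrdI2008, Prop. 1.6] -/
theorem fiberProduct_degFr {X Y : FiberProduct F G} (f : X ⟶ Y) :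
    degFr (fiberProductFunctor F G) f = degFr F f.fst := rfl

/-- If `γ′` is an isomorphism of `D′` then `γ` is a base-isomorphism of `C`
(`γ_D = α ∘ γ′_D ∘ β⁻¹`). [cite: MochizukiFrdI2008, Prop. 1.6] -/
theorem isBaseIso_fst_of_isIso_snd {X Y : FiberProduct F G} (f : X ⟶ Y) [IsIso f.snd] :
    IsBaseIso F f.fst := by
  have h : Base F f.fst = X.e.hom ≫ G.map f.snd ≫ Y.e.inv := by
    rw [← FiberProduct.inv_comp_base, Iso.hom_inv_id_assoc]
  show IsIso (Base F f.fst)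
  rw [h]
  infer_instance

/-! ### Lifting arrows of `C` with invertible projection to `C′` -/

namespace FiberProduct

/-- For `g : B → A` in `C` with `g_D` invertible and `X = (A, A′, α)`: the object `(B, A′, α ∘ g_D)`.
[cite: MochizukiFrdI2008, Prop. 1.6] -/
@[reducible] noncomputable def liftSrc (X : FiberProduct F G) {B : C} (g : B ⟶ X.fst)
    (hg : IsIso (Base F g)) : FiberProduct F G :=
  ⟨B, X.snd, @asIso _ _ _ _ (Base F g) hg ≪≫ X.e⟩

/-- The arrow `(g, id) : (B, A′, α ∘ g_D) → (A, A′, α)`. [cite: MochizukiFrdI2008, Prop. 1.6] -/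
noncomputable def liftSrcHom (X : FiberProduct F G) {B : C} (g : B ⟶ X.fst) (hg : IsIso (Base F g)) :
    liftSrc X g hg ⟶ X :=
  ⟨g, 𝟙 X.snd, by
    show Base F g ≫ X.e.hom = (Base F g ≫ X.e.hom) ≫ G.map (𝟙 X.snd)
    rw [G.map_id, Category.comp_id]⟩

/-- For `g : A → B` in `C` with `g_D` invertible and `X = (A, A′, α)`: the object
`(B, A′, α ∘ g_D⁻¹)`. [cite: MochizukiFrdI2008, Prop. 1.6] -/
@[reducible] noncomputable def liftTgt (X : FiberProduct F G) {B : C} (g : X.fst ⟶ B)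
    (hg : IsIso (Base F g)) : FiberProduct F G :=
  ⟨B, X.snd, (@asIso _ _ _ _ (Base F g) hg).symm ≪≫ X.e⟩

/-- The arrow `(g, id) : (A, A′, α) → (B, A′, α ∘ g_D⁻¹)`. [cite: MochizukiFrdI2008, Prop. 1.6] -/
noncomputable def liftTgtHom (X : FiberProduct F G) {B : C} (g : X.fst ⟶ B) (hg : IsIso (Base F g)) :
    X ⟶ liftTgt X g hg :=
  haveI := hg
  ⟨g, 𝟙 X.snd, by
    show Base F g ≫ inv (Base F g) ≫ X.e.hom = X.e.hom ≫ G.map (𝟙 X.snd)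
    rw [IsIso.hom_inv_id_assoc, G.map_id, Category.comp_id]⟩

end FiberProduct

/-! ### `C′` is a pre-Frobenioid (first half of the proof of Prop. 1.6 (ii)) -/

/-- "the fact that `D′` is a totally epimorphic category implies immediately that `C′` is as well"
(using also that `C` is). [cite: MochizukiFrdI2008, Prop. 1.6] -/
theorem isTotallyEpimorphic_fiberProduct (hC : IsTotallyEpimorphic C) (hD' : IsTotallyEpimorphic D') :
    IsTotallyEpimorphic (FiberProduct F G) := by
  refine ⟨fun {X Y} f => ⟨fun {Z} g h e => ?_⟩⟩
  haveI := hC.epi f.fst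
  haveI := hD'.epi f.snd
  exact CFP.hom_ext ((cancel_epi f.fst).mp (congrArg CFP.Hom.fst e))
    ((cancel_epi f.snd).mp (congrArg CFP.Hom.snd e))

/-- Two objects of `C′` over the same object of `D′` are connected (Def. 1.3 (i)(b) for `C`).
[cite: MochizukiFrdI2008, Prop. 1.6] -/
theorem zigzag_fiberProduct_same (hF : IsFrobenioid F) (A' : D') (A : C)
    (α : baseObj F A ≅ G.obj A') (B : C) (β : baseObj F B ≅ G.obj A') :
    Zigzag (⟨A, A', α⟩ : FiberProduct F G) ⟨B, A', β⟩ := by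
  obtain ⟨W, φ, ψ, hφ, _, hb⟩ := hF.i_b A B (α ≪≫ β.symm)
  let X : FiberProduct F G := ⟨A, A', α⟩
  have w₂ : Base F ψ ≫ β.hom = (Base F φ ≫ α.hom) ≫ G.map (𝟙 A') := by
    rw [G.map_id, Category.comp_id, ← hb]
    show (Base F φ ≫ α.hom ≫ β.inv) ≫ β.hom = Base F φ ≫ α.hom
    simp only [Category.assoc, Iso.inv_hom_id, Category.comp_id]
  exact Zigzag.of_inv_hom (FiberProduct.liftSrcHom X φ hφ.2)
    (⟨ψ, 𝟙 A', w₂⟩ : FiberProduct.liftSrc X φ hφ.2 ⟶ ⟨B, A', β⟩)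

/-- Every object of `D′` underlies an object of `C′` (Def. 1.3 (i)(a) for `C`).
[cite: MochizukiFrdI2008, Prop. 1.6] -/
theorem exists_fiberProduct_over (hF : IsFrobenioid F) (A' : D') :
    ∃ A : C, Nonempty (baseObj F A ≅ G.obj A') := by
  obtain ⟨A, _, ⟨α⟩⟩ := hF.i_a (G.obj A')
  exact ⟨A, ⟨α⟩⟩

/-- Every arrow `A₁′ → A₂′` of `D′` lifts to an arrow of `C′` into any given object over `A₂′`
(Def. 1.3 (i)(c) for `C`: essential surjectivity of `C^pl-bk_B → D_{B_D}`).
[cite: MochizukiFrdI2008, Prop. 1.6] -/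
theorem exists_fiberProduct_hom_over (hF : IsFrobenioid F) {A₁' A₂' : D'} (e' : A₁' ⟶ A₂') (B : C)
    (β : baseObj F B ≅ G.obj A₂') :
    ∃ (W : C) (ω : baseObj F W ≅ G.obj A₁'),
      Nonempty ((⟨W, A₁', ω⟩ : FiberProduct F G) ⟶ ⟨B, A₂', β⟩) := by
  haveI := hF.i_c B
  obtain ⟨P, ⟨e⟩⟩ :=
    Functor.EssSurj.mem_essImage (pullbackSliceToBase F B) (Over.mk (G.map e' ≫ β.inv))
  let i : baseObj F P.left.obj ≅ G.obj A₁' := (Over.forget _).mapIso e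
  have hw : i.hom ≫ (G.map e' ≫ β.inv) = Base F P.hom.1 := Over.w e.hom
  refine ⟨P.left.obj, i, ⟨⟨P.hom.1, e', ?_⟩⟩⟩
  show Base F P.hom.1 ≫ β.hom = i.hom ≫ G.map e'
  rw [← hw]
  simp only [Category.assoc, Iso.inv_hom_id, Category.comp_id]

/-- Objects of `C′` over `Zigzag`-related objects of `D′` are `Zigzag`-related.
[cite: MochizukiFrdI2008, Prop. 1.6] -/
theorem zigzag_fiberProduct (hF : IsFrobenioid F) {A' B' : D'} (h : Zigzag A' B') :
    ∀ (A : C) (α : baseObj F A ≅ G.obj A') (B : C) (β : baseObj F B ≅ G.obj B'),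
      Zigzag (⟨A, A', α⟩ : FiberProduct F G) ⟨B, B', β⟩ := by
  induction h with
  | refl => exact fun A α B β => zigzag_fiberProduct_same hF A' A α B β
  | tail _ hbc ih =>
    intro A α B β
    rcases hbc with ⟨⟨e'⟩⟩ | ⟨⟨e'⟩⟩
    · obtain ⟨W, ω, ⟨g⟩⟩ := exists_fiberProduct_hom_over (G := G) hF e' B β
      exact (ih A α W ω).trans (Zigzag.of_hom g)
    · obtain ⟨B₂, ⟨β₂⟩⟩ := exists_fiberProduct_over (G := G) hF _
      obtain ⟨W, ω, ⟨g⟩⟩ := exists_fiberProduct_hom_over (G := G) hF e' B₂ β₂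
      exact ((ih A α B₂ β₂).trans (Zigzag.of_inv g)).trans (zigzag_fiberProduct_same hF _ W ω B β)

/-- "the fact that `D′` is connected implies immediately that `C′` is also connected" [in light
of Def. 1.3 (i)(a)(b)(c)]. [cite: MochizukiFrdI2008, Prop. 1.6] -/
theorem isGraphConnected_fiberProduct (hF : IsFrobenioid F) (hD' : IsGraphConnected D') :
    IsGraphConnected (FiberProduct F G) := by
  obtain ⟨⟨A'⟩, hz⟩ := hD'
  obtain ⟨A, ⟨α⟩⟩ := exists_fiberProduct_over (G := G) hF A'
  refine ⟨⟨⟨A, A', α⟩⟩, fun X Y => ?_⟩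
  obtain ⟨XA, XA', Xα⟩ := X
  obtain ⟨YB, YB', Yβ⟩ := Y
  exact zigzag_fiberProduct hF (hz XA' YB') XA Xα YB Yβ

/-- **FrdI Prop. 1.6 (ii), first half**: `C′ → F_{Φ′}` is a pre-Frobenioid.
[cite: MochizukiFrdI2008, Prop. 1.6] -/
theorem isPreFrobenioid_fiberProduct (hF : IsFrobenioid F) (hD'c : IsGraphConnected D')
    (hD'e : IsTotallyEpimorphic D') (hG : ∀ {A B : D'} (f : B ⟶ A), IsFSM f → IsFSM (G.map f)) :
    IsPreFrobenioid (restrictMonoid Φ G) (fiberProductFunctor F G) where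
  isMonoidOn := isMonoidOn_restrictMonoid hF.isPreFrobenioid.isMonoidOn hG
  isDivisorial := objectwise_restrictMonoid hF.isPreFrobenioid.isDivisorial
  isGraphConnected_base := hD'c
  isTotallyEpimorphic_base := hD'e
  isGraphConnected := isGraphConnected_fiberProduct hF hD'c
  isTotallyEpimorphic := isTotallyEpimorphic_fiberProduct hF.isPreFrobenioid.isTotallyEpimorphic hD'e

end PreFrobenioid

end Literature.AlgebraicGeometry.Frobenioids
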